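import Literature.AlgebraicGeometry.Resolution.Macaulayfication
import Literature.AlgebraicGeometry.Resolution.Blowups
import Mathlib.AlgebraicGeometry.IdealSheaf.Functorial
import HarnessLib

/-!
# Cohen–Macaulay principalization (Česnavičius 2021, consequence of Macaulayfication) — named fact

Topic: `Literature/AlgebraicGeometry/Resolution`. Companion of `Macaulayfication.lean`
(`KawasakiMacaulayfication`: integral schemes of finite type over a field have proper birational integral
Cohen–Macaulay models). Česnavičius 2021 proves Macaulayfication in the sharp form "projective, and an
isomorphism over the Cohen–Macaulay locus" (Thm. 1.6 of arXiv:1810.04493 = Duke Math. J. 170 (2021)),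
and records the following **principalization** consequence (loc. cit., §1, the Corollary labelled
(principalize) right after the main theorem):

  *"For every Noetherian, Cohen–Macaulay scheme `X` and every closed subscheme `Z ⊂ X`, there are a
  Cohen–Macaulay scheme `X̃` and a projective morphism `X̃ → X` such that the scheme-theoretic preimage
  of `Z` in `X̃` is a divisor and `X̃ → X` is an isomorphism over the maximal open subscheme `U ⊂ X` on
  which `Z` is already a divisor."* (Proof sketch, loc. cit.: apply the main theorem, in its precise
  form Thm. 5.3 — a Macaulayfying blowing up that is an isomorphism over `U` — to `Bl_Z(X)`, which is
  CM-excellent and locally equidimensional, is an isomorphism over `U`, and in which the preimage of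
  `Z` is a divisor.)

Vendored here as a NAMED FACT (`def … : Prop`, not proved in the tree) in the special case and the
vocabulary of route `FrobeniusLadder` of summit `ResolutionOfSingularities` (crux `FRationalModification`,
line `birth`, stub `stub_cmCartierHull`, which applies it to `Z ⊇` the non-regular locus of an integral
Cohen–Macaulay variety):

* base = a field `k`, `X` INTEGRAL, separated and of finite type over `k` (finite-type `k`-schemes are
  excellent, hence CM-excellent, Česnavičius 2021 Ex. 1.3; so `X`, `Bl_Z X` qualify);
* "`X` Cohen–Macaulay" / "`X̃` Cohen–Macaulay" spelled stalkwise and inline exactly as in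
  `KawasakiMacaulayfication` (every system of parameters of every local ring is a weakly regular
  sequence; Bruns–Herzog 2.1.2 (d), 2.1.3 (b); Stacks 02IP);
* `Z` = a closed subscheme = a quasi-coherent ideal sheaf (Mathlib `Scheme.IdealSheafData`), assumed NOT
  to have full support (for `Supp Z = X` the printed statement degenerates to `X̃ = ∅`); its
  scheme-theoretic preimage is Mathlib's pull-back ideal sheaf `Z.comap π` (the kernel of
  `X̃ ×_X Z → X̃`), and "is a divisor" = is an effective Cartier divisor (`IsEffectiveCartier` of
  `Blowups.lean`: locally generated by one non-zero-divisor);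
* "isomorphism over `U`" is recorded over the possibly smaller open `X ∖ Supp Z ⊆ U` (where `Z` is the
  empty divisor), as `IsIso (π ∣_ (Supp Z)ᶜ)` — a weakening of the printed clause;
* two consequences the sources give are recorded in the conclusion for the consumers' convenience:
  `π` is proper (projective ⇒ proper) and BIRATIONAL in the sense of this directory (`IsBirational`: an
  isomorphism over the dense open `X ∖ Supp Z` of the integral `X`, whose preimage is a non-empty open of
  the integral `X̃`, hence dense), and `X̃` is INTEGRAL (it is a blow-up of the blow-up `Bl_Z X` of the
  integral scheme `X` in non-zero ideals — Česnavičius Thm. 5.3 produces a blowing up; blow-ups of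
  integral schemes in non-zero ideals are integral, Stacks 02ND).

## Sources

* K. Česnavičius, *Macaulayfication of Noetherian schemes*, Duke Math. J. 170 (2021) 1419–1455 =
  arXiv:1810.04493v2: Thm. 1.6 (main theorem), the Corollary (principalize) following it in §1 (quoted
  above), Ex. 1.3 (CM-excellence of finite-type schemes over a field), Thm. 5.3 / Rem. 5.4 (the
  Macaulayfying blow-up, isomorphism over the prescribed open). [Cesnavicius2021]
* T. Kawasaki, *On Macaulayfication of Noetherian schemes*, Trans. AMS 352 (2000), Thm. 1.1.
  [Kawasaki2000]
* The Stacks Project, Tags 02ND (blow-ups of integral schemes), 01WR–01WS (effective Cartier divisors),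
  02IP (Cohen–Macaulay schemes).

## What is NOT here

The proof (XL: Macaulayfication itself); the general base (Noetherian CM-quasi-excellent `X`);
projectivity of `π`; the isomorphism over the full maximal open `U` on which `Z` is already a divisor
(`-- TODO(general form)` below); Cohen–Macaulayness as a predicate (inline, as in `Macaulayfication.lean`).
-/

noncomputable section

open CategoryTheory AlgebraicGeometry TopologicalSpace

namespace Literature.AlgebraicGeometry.Resolution

universe u

/-- NAMED FACT — **Cohen–Macaulay principalization of a closed subscheme of an integral Cohen–Macaulay
variety** (Česnavičius 2021, §1, Corollary (principalize) of Thm. 1.6, special case `X` integral,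
separated and of finite type over a field `k`): *"For every Noetherian, Cohen–Macaulay scheme `X` and
every closed subscheme `Z ⊂ X`, there are a Cohen–Macaulay scheme `X̃` and a projective morphism `X̃ → X`
such that the scheme-theoretic preimage of `Z` in `X̃` is a divisor and `X̃ → X` is an isomorphism over
the maximal open subscheme `U ⊂ X` on which `Z` is already a divisor."* Rendering: `X/k` integral,
separated, of finite type, with Cohen–Macaulay stalks (every system of parameters a weakly regular
sequence); `Z : X.IdealSheafData` with `Supp Z ≠ X`; conclusion: a proper BIRATIONAL `π : X₁ → X` with
`X₁` integral and Cohen–Macaulay stalkwise, the pulled-back ideal sheaf `Z.comap π` an effective Cartier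
divisor (`IsEffectiveCartier`), and `π` an isomorphism over `X ∖ Supp Z` (`IsIso (π ∣_ (Supp Z)ᶜ)`).
Users take `(h : CesnaviciusPrincipalization)`.
-- TODO(general form): X Noetherian Cohen–Macaulay and CM-quasi-excellent, π projective, and an
-- isomorphism over the maximal open U ⊂ X on which Z is already an effective Cartier divisor
-- (Česnavičius 2021, Cor. (principalize); Thm. 5.3, Rem. 5.4).
[cite: Cesnavicius2021, §1 Corollary (principalize) after Thm. 1.6] -/
def CesnaviciusPrincipalization : Prop :=
  ∀ (k : Type u) [Field k] (X : Scheme.{u}) (f : X ⟶ Spec (.of k)),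
    IsSeparated f → LocallyOfFiniteType f → QuasiCompact f → IsIntegral X →
      (∀ x : X, ∀ d : ℕ, ringKrullDim (X.presheaf.stalk x) = d →
        ∀ s : Fin d → X.presheaf.stalk x, (Ideal.span (Set.range s)).radical.IsMaximal →
          RingTheory.Sequence.IsWeaklyRegular (X.presheaf.stalk x) (List.ofFn s)) →
      ∀ Z : X.IdealSheafData, Z.support ≠ ⊤ →
        ∃ (X₁ : Scheme.{u}) (π : X₁ ⟶ X), IsProper π ∧ IsBirational π ∧ IsIntegral X₁ ∧
          (∀ x : X₁, ∀ d : ℕ, ringKrullDim (X₁.presheaf.stalk x) = d →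
            ∀ s : Fin d → X₁.presheaf.stalk x, (Ideal.span (Set.range s)).radical.IsMaximal →
              RingTheory.Sequence.IsWeaklyRegular (X₁.presheaf.stalk x) (List.ofFn s)) ∧
          IsEffectiveCartier (Z.comap π) ∧ IsIso (π ∣_ Z.support.compl)

/-- The trivial instance (consistency of the rendering): if `Z` is already an effective Cartier divisor
on the integral Cohen–Macaulay `X`, then `X₁ = X`, `π = 𝟙` works (`Z.comap (𝟙 X) = Z`,
Mathlib `Scheme.IdealSheafData.comap_id`). [folklore] -/
theorem cesnaviciusPrincipalization_of_isEffectiveCartier (X : Scheme.{u}) [IsIntegral X]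
    (hCM : ∀ x : X, ∀ d : ℕ, ringKrullDim (X.presheaf.stalk x) = d →
      ∀ s : Fin d → X.presheaf.stalk x, (Ideal.span (Set.range s)).radical.IsMaximal →
        RingTheory.Sequence.IsWeaklyRegular (X.presheaf.stalk x) (List.ofFn s))
    (Z : X.IdealSheafData) (hZ : IsEffectiveCartier Z) :
    ∃ (X₁ : Scheme.{u}) (π : X₁ ⟶ X), IsProper π ∧ IsBirational π ∧ IsIntegral X₁ ∧
      (∀ x : X₁, ∀ d : ℕ, ringKrullDim (X₁.presheaf.stalk x) = d →
        ∀ s : Fin d → X₁.presheaf.stalk x, (Ideal.span (Set.range s)).radical.IsMaximal →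
          RingTheory.Sequence.IsWeaklyRegular (X₁.presheaf.stalk x) (List.ofFn s)) ∧
      IsEffectiveCartier (Z.comap π) ∧ IsIso (π ∣_ Z.support.compl) := by
  refine ⟨X, 𝟙 X, inferInstance, ⟨⊤, by simp, by simp, inferInstance⟩, inferInstance, hCM, ?_,
    inferInstance⟩
  rw [Scheme.IdealSheafData.comap_id]
  exact hZ

end Literature.AlgebraicGeometry.Resolution

end
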